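import Literature.MathematicalPhysics.QuantumLattice.HubbardTorusRepulsionGap
import Literature.MathematicalPhysics.QuantumLattice.HubbardGroundStateDoublonBound
import Literature.MathematicalPhysics.QuantumLattice.HubbardNNNHopping
import HarnessLib

/-!
# Hole/doublon counting floor and the doublon-free ceiling for the `t–t'` Hubbard torus

Topic `Literature/MathematicalPhysics/QuantumLattice` (family `hubbard`). Everything here is PROVED (no
named fact, no definition). The `t–t'` Hubbard model on the square torus `(ℤ/L)²`,
`hubbardTorusTT' L t t' U = hamiltonian (NN graph) t U + hamiltonian (diagonal graph) t' 0`
(`HubbardNNNHopping.lean`), obeys the same two elementary energy brackets as the nearest-neighbour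
model (`HubbardHoleCountingBound.lean`, `HubbardTorusRepulsionGap.lean`,
`HubbardGroundStateDoublonBound.lean`), for EVERY real `t'`:

* **upper (doublon-free trial state, `t = 1`).** A configuration `|A↑ ∪ B↓⟩` with `A ∩ B = ∅` has
  energy `0` (`star_single_pairSet_hubbardTorusTT'_eq_zero`: every hopping term moves an electron and so
  has no diagonal matrix element; the repulsion sees no doublon), hence `E^{tt'}_L(U; 2n, S^z = 0) ≤ 0`
  for `2n ≤ L²` (`minEnergyOn_szSector_hubbardTorusTT'_le_zero`) — the atomic-limit picture of Tasaki
  (1998) §3.2 (configurations without doubly occupied sites are the zero-energy ground states of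
  `H_int`) and §5.1 (the hopping term has no diagonal elements between them);
* **lower (Nagaoka–Brinkman–Rice hole counting).** The diagonal graph has maximal degree `4`
  (`card_filter_fermionTorusDiagGraph_adj_le`), so the hole/doublon counting inequality of
  `HubbardHoleCountingBound.lean` applies to BOTH hopping terms (with `|t| = 1` resp. `|t'|`, `Δ = 4`):
  for a unit vector `ψ` of the `N`-particle sector and every `ω > 0`,
  `Re⟨ψ, H^{tt'} ψ⟩ ≥ -4(|t| + |t'|)((L² - N) + ωL²) + (U - 4(|t| + |t'|)(2 + 2ω⁻¹)) ⟨D⟩_ψ`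
  (`holeCounting_le_re_expect_hubbardTorusTT'`), and therefore, for `U ≥ (|t| + |t'|)(8 + 8ω⁻¹)`,
  `E^{tt'}_L(U; N, M) ≥ -4(|t| + |t'|)((L² - N) + ωL²)` on every nonempty joint sector
  (`hubbardTorusTT'_holeCounting_floor`): at strong coupling the energy per site is
  `≥ -z(|t| + |t'|)·(hole density) - O((|t| + |t'|)²/U)`, `z = 4` — the hole-bandwidth count
  `-z|t|` per hole of Nagaoka (1966) §II (one hole, `U = ∞`; Tasaki 1998 Thm. 6.3) and Brinkman–Rice
  (1970), here for the band `-2t(cos k_x + cos k_y) - 4t' cos k_x cos k_y` and made rigorous for all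
  fillings by the counting inequality.

These are the two brackets consumed by the strong-coupling superfluid-stiffness ceilings of the cell
`Summits/HubbardSuperconductivity/HubbardLadder/Bounds/` (`StrongCouplingStiffnessCeilingTPrime.lean`).

## References

* Y. Nagaoka, *Ferromagnetism in a narrow, almost half-filled s band*, Phys. Rev. 147 (1966) 392–405,
  §II [Nagaoka1966].
* W. F. Brinkman, T. M. Rice, *Application of Gutzwiller's variational method to the metal–insulator
  transition*, Phys. Rev. B 2 (1970) 4302–4304 [BrinkmanRice1970].
* H. Tasaki, *The Hubbard model — an introduction and selected rigorous results*, J. Phys.: Condens.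
  Matter 10 (1998) 4353–4378, §3.2, §5.1, §6.3 [Tasaki1998].

## Mathlib / tree search

`hubbardTorusTT'`, `fermionTorusDiagGraph`, `torusDiagGraph`, `torusDiagJump` (`HubbardNNNHopping`);
`holeCounting_le_re_expect_hamiltonian`, `card_filter_fermionTorusGraph_adj_le`,
`hubbardTorus_holeCounting_floor` (the `t' = 0`, `t = 1` case); `star_single_pairSet_hubbardTorus_eq_zero`,
`minEnergyOn_szSector_hubbardTorus_le_zero`, `creation_mul_annihilation_apply_self_eq_zero`
(`HubbardGroundStateDoublonBound`). No `t'`-version of either bracket existed (`lean search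
"hubbardTorusTT'.*minEnergyOn"`, `"fermionTorusDiagGraph.*card"`: no hits).
-/

noncomputable section

namespace Literature.MathematicalPhysics.QuantumLattice

open Matrix Finset
open Literature.MathematicalPhysics.QuantumFieldTheory
open scoped ComplexOrder ComplexConjugate

variable {L : ℕ}

/-! ### The diagonal graph has maximal degree `4` -/

/-- Degrees of the diagonal (next-nearest-neighbour) graph of the two-dimensional fermionic torus are
`≤ 4`: the neighbours of `v` lie in `{v ± (e₀ + e₁), v ± (e₀ - e₁)}` (private helper). [folklore] -/
private theorem card_filter_fermionTorusDiagGraph_adj_le [NeZero L] (v : FermionTorus 2 L) :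
    (Finset.univ.filter ((fermionTorusDiagGraph L).Adj v)).card ≤ 4 := by
  classical
  have hsub : (Finset.univ.filter ((fermionTorusDiagGraph L).Adj v)).image FermionTorus.toTorusSite ⊆
      (Finset.univ : Finset (Fin 2 × Bool)).image fun p =>
        if p.2 then v.toTorusSite + torusDiagJump L p.1 else v.toTorusSite - torusDiagJump L p.1 := by
    intro z hz
    obtain ⟨w, hw, rfl⟩ := Finset.mem_image.1 hz
    have hadj : (torusDiagGraph L).Adj v.toTorusSite w.toTorusSite := (Finset.mem_filter.1 hw).2
    rw [torusDiagGraph, SimpleGraph.fromRel_adj] at hadj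
    obtain ⟨-, ⟨s, h⟩ | ⟨s, h⟩⟩ := hadj
    · exact Finset.mem_image.2 ⟨(s, true), Finset.mem_univ _, by simp [h]⟩
    · refine Finset.mem_image.2 ⟨(s, false), Finset.mem_univ _, ?_⟩
      simp only [if_false, Bool.false_eq_true]
      rw [h, add_sub_cancel_right]
  calc (Finset.univ.filter ((fermionTorusDiagGraph L).Adj v)).card
      = ((Finset.univ.filter ((fermionTorusDiagGraph L).Adj v)).image FermionTorus.toTorusSite).card :=
        (Finset.card_image_of_injective _ FermionTorus.equivTorusSite.injective).symm
    _ ≤ ((Finset.univ : Finset (Fin 2 × Bool)).image fun p =>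
          if p.2 then v.toTorusSite + torusDiagJump L p.1 else v.toTorusSite - torusDiagJump L p.1).card :=
        Finset.card_le_card hsub
    _ ≤ (Finset.univ : Finset (Fin 2 × Bool)).card := Finset.card_image_le
    _ = 4 := by simp

/-! ### The doublon-free ceiling `E^{tt'} ≤ 0` -/

/-- A pure hopping Hamiltonian (`U = 0`, any coupling `t`, any graph) has vanishing diagonal entries in
the occupation basis: every term `c†_{xσ} c_{yσ}`, `x ∼ y`, changes the configuration (private helper;
Tasaki 1998 §5.1). [folklore] -/
private theorem hamiltonian_zero_coupling_apply_self {Λ : Type*} [LinearOrder Λ] [Fintype Λ]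
    (G : SimpleGraph Λ) [DecidableRel G.Adj] (t : ℝ) (s : Finset (Orb Λ)) :
    hamiltonian G t 0 s s = 0 := by
  unfold hamiltonian
  simp only [Matrix.add_apply, Matrix.smul_apply, Matrix.sum_apply, Complex.ofReal_zero, zero_smul,
    Matrix.zero_apply, add_zero]
  rw [Finset.sum_eq_zero fun x _ => Finset.sum_eq_zero fun y _ => Finset.sum_eq_zero fun σ _ => ?_]
  · simp
  · split_ifs with hxy
    · exact creation_mul_annihilation_apply_self_eq_zero (fun h => G.ne_of_adj hxy (orb_inj.1 h).1) _
    · rfl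

/-- The energy of the doublon-free configuration `|A↑ ∪ B↓⟩` (`A ∩ B = ∅`) in the `t–t'` torus
(`t = 1`) is `0`, for every `t'` and `U`: the configuration has no doubly occupied site, so it is a
zero-energy eigenvector of the repulsion, and both hopping terms have vanishing diagonal elements.
[cite: Tasaki1998, §3.2] -/
theorem star_single_pairSet_hubbardTorusTT'_eq_zero (t' U : ℝ) {A B : Finset (FermionTorus 2 L)}
    (hAB : Disjoint A B) :
    (star (Pi.single (pairSet A B) (1 : ℂ)) ⬝ᵥ
      (hubbardTorusTT' L 1 t' U *ᵥ Pi.single (pairSet A B) 1)).re = 0 := by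
  rw [hubbardTorusTT', Matrix.add_mulVec, dotProduct_add, Complex.add_re, ← hubbardTorus,
    star_single_pairSet_hubbardTorus_eq_zero L U hAB,
    Literature.Computability.AlgebraicComplexity.star_single_dotProduct_mulVec_single,
    hamiltonian_zero_coupling_apply_self]
  simp

/-- **Doublon-free ceiling, `t–t'` torus**: `E^{tt'}_L(U; 2n, S^z = 0) ≤ 0` for `2n ≤ L²`, every `t'`
and `U` (trial configuration: `n` up-spins and `n` down-spins on disjoint sites — the atomic-limit
ground states). [cite: Tasaki1998, §3.2] -/
theorem minEnergyOn_szSector_hubbardTorusTT'_le_zero (t' U : ℝ) {n : ℕ} (hn : 2 * n ≤ L ^ 2) :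
    (hubbardTorusTT' L 1 t' U).minEnergyOn (szSector (Λ := FermionTorus 2 L) (2 * n) 0) ≤ 0 := by
  classical
  have hcard : 2 * n ≤ (Finset.univ : Finset (FermionTorus 2 L)).card := by
    rw [Finset.card_univ]
    simpa [FermionTorus, Fintype.card_fin] using hn
  obtain ⟨C, -, hC⟩ := Finset.exists_subset_card_eq hcard
  have hnC : n ≤ C.card := by omega
  obtain ⟨A, hAC, hA⟩ := Finset.exists_subset_card_eq hnC
  set B := C \ A with hB
  have hBcard : B.card = n := by
    rw [hB, Finset.card_sdiff, Finset.inter_eq_left.2 hAC, hC, hA]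
    omega
  have hAB : Disjoint A B := by
    rw [hB]
    exact Finset.disjoint_sdiff
  have hmem : (Pi.single (pairSet A B) (1 : ℂ) : Fock (Orb (FermionTorus 2 L))) ∈
      szSector (Λ := FermionTorus 2 L) (2 * n) 0 := by
    rw [mem_szSector_two_mul_zero_iff]
    intro s hs
    by_cases hs0 : s = pairSet A B
    · subst hs0
      exact absurd ⟨by rw [upPart_pairSet, hA], by rw [downPart_pairSet, hBcard]⟩ hs
    · simp [hs0]
  have h1 : star (Pi.single (pairSet A B) (1 : ℂ) : Fock (Orb (FermionTorus 2 L))) ⬝ᵥ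
      Pi.single (pairSet A B) 1 = 1 :=
    Literature.Computability.AlgebraicComplexity.star_single_dotProduct_single _
  have hle := minEnergyOn_le_rayleigh_of_mem (hubbardTorusTT'_isHermitian L 1 t' U) _ hmem h1
  rw [star_single_pairSet_hubbardTorusTT'_eq_zero t' U hAB] at hle
  exact hle

/-! ### The hole-counting floor for the `t–t'` torus -/

/-- **Hole counting bounds the `t–t'` Hubbard energy from below** (any real `t`, `t'`; `ω > 0`): for a
unit vector `ψ` of the `N`-particle sector,
`Re⟨ψ, H^{tt'} ψ⟩ ≥ -4(|t| + |t'|)((L² - N) + ωL²) + (U - 4(|t| + |t'|)(2 + 2ω⁻¹)) Re⟨ψ, Σ_x n_{x↑}n_{x↓} ψ⟩`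
— the kinetic energy available is at most `z(|t| + |t'|)`, `z = 4`, per HOLE (plus the doublon and
virtual-fluctuation charges): the counting inequality of `HubbardHoleCountingBound` on the NN graph and
on the diagonal graph (both of maximal degree `4`), added. Nagaoka's `U = ∞` one-hole value `-z|t|`
(1966, §II; Tasaki 1998 Thm. 6.3) and the Brinkman–Rice hole-bandwidth count, as a rigorous inequality
for all fillings. [cite: Nagaoka1966, §II] -/
theorem holeCounting_le_re_expect_hubbardTorusTT' [NeZero L] (t t' U : ℝ) {ω : ℝ} (hω : 0 < ω)
    {N : ℕ} {ψ : Fock (Orb (FermionTorus 2 L))} (hN : IsNParticle N ψ) (hψ : star ψ ⬝ᵥ ψ = 1) :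
    -(4 * (|t| + |t'|) * (((L : ℝ) ^ 2 - N) + ω * (L : ℝ) ^ 2)) +
        (U - 4 * (|t| + |t'|) * (2 + 2 * ω⁻¹)) *
          (star ψ ⬝ᵥ ((∑ x : FermionTorus 2 L, numberOp x 0 * numberOp x 1) *ᵥ ψ)).re ≤
      (star ψ ⬝ᵥ (hubbardTorusTT' L t t' U *ᵥ ψ)).re := by
  have hΔ : ∀ v : FermionTorus 2 L,
      (Finset.univ.filter ((fermionTorusGraph 2 L).Adj v)).card ≤ 4 := fun v =>
    card_filter_fermionTorusGraph_adj_le v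
  have hΔ' : ∀ v : FermionTorus 2 L,
      (Finset.univ.filter ((fermionTorusDiagGraph L).Adj v)).card ≤ 4 := fun v =>
    card_filter_fermionTorusDiagGraph_adj_le v
  have hn := holeCounting_le_re_expect_hamiltonian (fermionTorusGraph 2 L) hΔ t U hω hN hψ
  have hd := holeCounting_le_re_expect_hamiltonian (fermionTorusDiagGraph L) hΔ' t' 0 hω hN hψ
  have hcard : Fintype.card (FermionTorus 2 L) = L ^ 2 := by simp [FermionTorus, Fintype.card_lex]
  rw [hcard] at hn hd
  push_cast at hn hd
  have hsplit : (star ψ ⬝ᵥ (hubbardTorusTT' L t t' U *ᵥ ψ)).re =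
      (star ψ ⬝ᵥ (hamiltonian (fermionTorusGraph 2 L) t U *ᵥ ψ)).re +
        (star ψ ⬝ᵥ (hamiltonian (fermionTorusDiagGraph L) t' 0 *ᵥ ψ)).re := by
    rw [hubbardTorusTT', Matrix.add_mulVec, dotProduct_add, Complex.add_re]
  rw [hsplit]
  linarith

/-- **Hole counting floor, `t–t'` torus.** For `ω > 0`, `U ≥ (|t| + |t'|)(8 + 8ω⁻¹)` and a nonempty
joint sector `(N, S^z = M)`: `E^{tt'}_L(U; N, M) ≥ -4(|t| + |t'|)((L² - N) + ωL²)` — energy per site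
`≥ -z(|t| + |t'|)·(hole density) - z(|t| + |t'|)ω`, `z = 4`, uniformly in the volume (the `t' = 0`,
`t = 1` case is `hubbardTorus_holeCounting_floor`). [cite: Nagaoka1966, §II] -/
theorem hubbardTorusTT'_holeCounting_floor [NeZero L] {t t' U ω : ℝ} (hω : 0 < ω)
    (hU : (|t| + |t'|) * (8 + 8 * ω⁻¹) ≤ U) (N : ℕ) (M : ℝ)
    (hK : ∃ ψ ∈ szSector (Λ := FermionTorus 2 L) N M, star ψ ⬝ᵥ ψ = 1) :
    -(4 * (|t| + |t'|) * (((L : ℝ) ^ 2 - N) + ω * (L : ℝ) ^ 2)) ≤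
      (hubbardTorusTT' L t t' U).minEnergyOn (szSector N M) := by
  obtain ⟨ψ₀, hψ₀K, hψ₀⟩ := hK
  refine le_csInf ⟨_, ψ₀, hψ₀K, hψ₀, rfl⟩ ?_
  rintro E ⟨ψ, hψK, hψ1, rfl⟩
  have hN : IsNParticle N ψ := ((mem_szSector_iff N M ψ).1 hψK).1
  have h := holeCounting_le_re_expect_hubbardTorusTT' t t' U hω hN hψ1
  have hDnn : 0 ≤ (star ψ ⬝ᵥ ((∑ x : FermionTorus 2 L, numberOp x 0 * numberOp x 1) *ᵥ ψ)).re := by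
    rw [re_expect_interaction_eq_sum]
    positivity
  have hcoef : 0 ≤ U - 4 * (|t| + |t'|) * (2 + 2 * ω⁻¹) := by nlinarith [hU]
  nlinarith [mul_nonneg hcoef hDnn]

end Literature.MathematicalPhysics.QuantumLattice

end
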